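import Literature.Claims.NS.Santak2026
import Literature.Analysis.FluidPDE.ClassicalSolutionRescale
import Literature.Analysis.FluidPDE.NSTaoClassOfSobolevDatum
import Literature.Analysis.FluidPDE.FlatSwirlGauge
import Literature.Analysis.FunctionSpaces.PoincareWirtingerConvex
import Summits.NavierStokesRegularity.NavierStokesRegularity.Theorems.SoloRefuteChishtie2025
import HarnessLib

/-!
# D-0090 NS-CLAIMS SWEEP — C102 `Santak2026`: the vorticity ODE (7) fails for EVERY substrate

Refuter of record ns-claims-refuter-6 g3 (cell ns-claims; typed skeleton
`Literature/Claims/NS/Santak2026.lean`, typist-4 g5, p518237).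

**Located step.** `Literature.Claims.NS.Santak2026.Step4_ODE7 N` = display (7), §5 p.3 l.57–71 of
A. Šantak, Zenodo 21607937 (2026): along every Beale–Kato–Majda-class solution of (1)–(2) from a
`C_c^∞` divergence-free datum, `X(t) = ‖ω(t)‖_{L∞}` is finite, continuous, differentiable on `(0,T)` and
`dX/dt ≤ C X²(1 − log(e+X)/Ψ₀) − c₀ X³/log(e+X)` with the substrate constants of `N`. It is the first
CONSUMED step of `claim_of_steps` that fails (Step 1 is a tree theorem; Steps 2–3 are the printed
support of (7), unconsumed; Step 5 is a true barrier lemma).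

**Kill (KILL ROUTE 2, scaling audit).** For every `N : Substrate`, `¬ Step4_ODE7 N`
(`not_Step4_ODE7`). The Navier–Stokes scaling `u_c(t,x) = c u(c²t, cx)`, `p_c = c² p(c²t, cx)`
(Leray 1934 §20; tree `IsClassicalNSSolutionOn.nsRescale_holds`) maps the typed solution class to
itself (`isLocalSolution_nsRescale`: the datum stays `C_c^∞` and divergence free, the BKM Sobolev
bounds persist by the tree's `hasBoundedSobolevNormsOn_of_sobolevDatum_unforced`), and multiplies
`X` by `c²` (`X_nsRescale`) and `dX/dt` by `c⁴`, while the cubic term of `rhs7 N` picks up `c⁶/log`.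
Take ONE local solution from the explicit datum `u₀ = curl(χ A)` of `SoloRefuteChishtie2025`
(`curl u₀ (0) ≠ 0`, so `X(0) > 0`); Step 4 itself makes `X` continuous, hence `X(s₀) = B > 0` at some
interior `s₀`, and differentiable there with derivative `d`. Step 4 applied to `u_c` at `s₀/c²` reads
`c⁴ d ≤ rhs7 N (c² B)` for all `c > 0`, i.e. `rhs7 N y ≥ (d/B²) y²` for all `y > 0` — impossible since
`rhs7 N y / y² → −∞` (`exists_rhs7_lt`).

CLASS (refuter's reading; the referee decides): false lemma (countermodel) at Step 4 (7) p.3 — the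
inequality (7) with universal constants is not invariant under the symmetry of (1)–(2) it is asserted
for. Nothing is said about Steps 2–3 ((5), Lemma 4.1) beyond the module docstring of the skeleton.

WHAT THIS IS NOT: not a claim about NS regularity or blow-up; not a claim about any author beyond
the typed locator.
-/

set_option linter.dupNamespace false

open Set Function MeasureTheory Filter Topology
open scoped ContDiff ENNReal NNReal Topology
open Literature.Claims.NS Literature.Analysis.FluidPDE
open Summit.NavierStokesRegularity.NavierStokesRegularity.Theorems.Chishtie2025 (datum contDiff_datum
  hasCompactSupport_datum isDivFree_datum hasFDerivAt_datum VL P_apply)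

noncomputable section

namespace Summit.NavierStokesRegularity.NavierStokesRegularity.Theorems.Santak2026

local notation "ℝ³" => EuclideanSpace ℝ (Fin 3)

/-! ## Scaling of the vorticity sup-norm -/

/-- `‖curl (c v(c ·))‖_∞ = c² ‖curl v‖_∞` for `c > 0`. -/
theorem vortSup_smul_comp_smul (v : ℝ³ → ℝ³) {c : ℝ} (hc : 0 < c) :
    Santak2026.vortSup (fun y => c • v (c • y)) = ENNReal.ofReal (c * c) * Santak2026.vortSup v := by
  unfold Santak2026.vortSup
  simp_rw [curl_smul_comp_smul, enorm_smul]
  rw [← ENNReal.mul_iSup, Real.enorm_eq_ofReal (mul_self_nonneg c)]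
  congr 1
  have hsurj : Surjective fun y : ℝ³ => c • y := fun z =>
    ⟨c⁻¹ • z, by simp [smul_smul, hc.ne']⟩
  exact hsurj.iSup_comp fun z => ‖curl v z‖ₑ

/-- `X` of the rescaled field: `X_{u_c}(t) = c² X_u(c² t)`. -/
theorem X_nsRescale (u : ℝ → ℝ³ → ℝ³) {c : ℝ} (hc : 0 < c) (t : ℝ) :
    Santak2026.X (nsRescale c u) t = c ^ 2 * Santak2026.X u (c ^ 2 * t) := by
  unfold Santak2026.X
  have h : nsRescale c u t = fun y => c • u (c ^ 2 * t) (c • y) := rfl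
  rw [h, vortSup_smul_comp_smul _ hc, ENNReal.toReal_mul, ENNReal.toReal_ofReal (mul_self_nonneg c)]
  ring

/-! ## The datum class under scaling -/

/-- All `L²` Sobolev norms of a smooth compactly supported field are finite. -/
theorem lintegral_iteratedFDeriv_sq_lt_top {f : ℝ³ → ℝ³} (hf : ContDiff ℝ ∞ f)
    (hs : HasCompactSupport f) (n : ℕ) : ∫⁻ x, ‖iteratedFDeriv ℝ n f x‖ₑ ^ 2 < ⊤ := by
  have hg : Continuous (iteratedFDeriv ℝ n f) :=
    hf.continuous_iteratedFDeriv (m := n) (by exact_mod_cast le_top)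
  have hcont : Continuous fun x => ‖iteratedFDeriv ℝ n f x‖ * ‖iteratedFDeriv ℝ n f x‖ :=
    hg.norm.mul hg.norm
  have hsupp : HasCompactSupport fun x => ‖iteratedFDeriv ℝ n f x‖ * ‖iteratedFDeriv ℝ n f x‖ :=
    (hs.iteratedFDeriv (𝕜 := ℝ) n).norm.mul_right
  have hint := (hcont.integrable_of_hasCompactSupport (μ := volume) hsupp).lintegral_lt_top
  refine lt_of_le_of_lt (le_of_eq (lintegral_congr fun x => ?_)) hint
  rw [ENNReal.ofReal_mul (norm_nonneg _), ofReal_norm, sq]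

/-- The datum class of the skeleton (`C^∞`, divergence free, all Sobolev norms finite, compact support)
is invariant under `u₀ ↦ c u₀(c ·)`, `c ≠ 0`. -/
theorem isDatum_nsRescaleData {u₀ : ℝ³ → ℝ³} (h : Santak2026.IsDatum u₀) {c : ℝ} (hc : c ≠ 0) :
    Santak2026.IsDatum (nsRescaleData c u₀) := by
  obtain ⟨⟨hsm, hdiv, -⟩, hcs⟩ := h
  have hdef : nsRescaleData c u₀ = fun x => c • u₀ (c • x) := rfl
  have hsm' : ContDiff ℝ ∞ (nsRescaleData c u₀) := by
    rw [hdef]; exact (hsm.comp (contDiff_const_smul c)).const_smul c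
  have hcs' : HasCompactSupport (nsRescaleData c u₀) := by
    rw [hdef]; exact (hcs.comp_smul hc).comp_left (g := fun v : ℝ³ => c • v) (smul_zero c)
  refine ⟨⟨hsm', fun x => ?_, fun n => lintegral_iteratedFDeriv_sq_lt_top hsm' hcs' n⟩, hcs'⟩
  have hx := hdiv (c • x)
  unfold VectorCalculus.divergence at hx ⊢
  rw [hdef, fderiv_const_smul_comp_smul_apply, ContinuousLinearMap.toLinearMap_smul, map_smul, hx,
    smul_zero]

/-! ## The solution class under scaling -/

/-- `(c² ·)⁻¹' [0, T) = [0, T/c²)`. -/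
theorem preimage_Ico (T : ℝ) {c : ℝ} (hc : 0 < c) :
    (fun t => c ^ 2 * t) ⁻¹' Ico 0 T = Ico 0 (T / c ^ 2) := by
  have hc2 : 0 < c ^ 2 := by positivity
  ext t
  simp only [mem_preimage, mem_Ico]
  rw [lt_div_iff₀ hc2, mul_comm (c ^ 2) t, mul_nonneg_iff_of_pos_right hc2]

/-- **The typed local-solution class is scale covariant**: if `(u, p)` is a BKM-class solution on
`[0,T)` from the datum `u₀` (`IsDatum`), then `(c u(c²t, cx), c² p(c²t, cx))` is one on `[0, T/c²)`
from `c u₀(c ·)`, `c > 0` (Leray's scaling; the Sobolev bounds persist by the tree's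
`hasBoundedSobolevNormsOn_of_sobolevDatum_unforced`). -/
theorem isLocalSolution_nsRescale {ν T c : ℝ} (hν : 0 < ν) (hT : 0 < T) (hc : 0 < c)
    {u₀ : ℝ³ → ℝ³} {u : ℝ → ℝ³ → ℝ³} {p : ℝ → ℝ³ → ℝ} (h₀ : Santak2026.IsDatum u₀)
    (h : Chae2007.IsLocalSolution ν T u₀ u p) :
    Chae2007.IsLocalSolution ν (T / c ^ 2) (nsRescaleData c u₀) (nsRescale c u)
      (nsRescalePressure c p) := by
  have hc2 : 0 < c ^ 2 := by positivity
  have hf0 : nsRescaleForce c (0 : ℝ → ℝ³ → ℝ³) = 0 := by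
    funext t x; simp [nsRescaleForce]
  have key : IsClassicalNSSolutionOn (Ico 0 (T / c ^ 2)) ν 0 (nsRescale c u)
      (nsRescalePressure c p) := by
    have h1 := IsClassicalNSSolutionOn.nsRescale_holds h.isClassical hc
    rwa [hf0, preimage_Ico T hc] at h1
  have hinit : nsRescale c u 0 = nsRescaleData c u₀ := by rw [nsRescale_zero_time, h.initial]
  have hdat := isDatum_nsRescaleData h₀ hc.ne'
  refine ⟨key, hinit, fun T'' hT'' => ?_⟩
  -- work on the closed slab `[0, T₁]`, `T₁ = max T'' (T/(2c²)) ∈ (0, T/c²)`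
  set T₁ : ℝ := max T'' (T / c ^ 2 / 2) with hT₁def
  have hT₁pos : 0 < T₁ := lt_max_of_lt_right (by positivity)
  have hT₁lt : T₁ < T / c ^ 2 := max_lt hT'' (by linarith [div_pos hT hc2])
  have hcl : IsClassicalNSSolutionOn (Icc 0 T₁) ν 0 (nsRescale c u) (nsRescalePressure c p) :=
    key.mono (Icc_subset_Ico_right hT₁lt) (uniqueDiffOn_Icc hT₁pos)
  -- energy bound on `[0, T₁]` from the `n = 0` Sobolev bound of `u` on `[0, c² T₁]`
  have hlt : c ^ 2 * T₁ < T := by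
    have := (lt_div_iff₀ hc2).mp hT₁lt; linarith
  obtain ⟨C, hC⟩ := h.sobolev (c ^ 2 * T₁) hlt 0
  set K : ℝ≥0∞ := ‖c‖ₑ ^ 2 * (ENNReal.ofReal |(c ^ Module.finrank ℝ ℝ³)⁻¹| * C) with hKdef
  have hKne : K ≠ ⊤ :=
    ENNReal.mul_ne_top (ENNReal.pow_ne_top enorm_ne_top)
      (ENNReal.mul_ne_top ENNReal.ofReal_ne_top ENNReal.coe_ne_top)
  have hE : ∃ C' : ℝ≥0, ∀ t ∈ Icc 0 T₁, ∫⁻ x, ‖nsRescale c u t x‖ₑ ^ 2 ≤ C' := by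
    refine ⟨K.toNNReal, fun t ht => ?_⟩
    rw [ENNReal.coe_toNNReal hKne, hKdef]
    have hs : c ^ 2 * t ∈ Icc 0 (c ^ 2 * T₁) :=
      ⟨mul_nonneg hc2.le ht.1, mul_le_mul_of_nonneg_left ht.2 hc2.le⟩
    have hcv : ∫⁻ x, ‖u (c ^ 2 * t) (c • x)‖ₑ ^ 2 =
        ENNReal.ofReal |(c ^ Module.finrank ℝ ℝ³)⁻¹| * ∫⁻ y, ‖u (c ^ 2 * t) y‖ₑ ^ 2 :=
      Literature.Analysis.FunctionSpaces.lintegral_comp_smul volume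
        (fun y => ‖u (c ^ 2 * t) y‖ₑ ^ 2) hc.ne'
    have h0 : ∫⁻ y, ‖u (c ^ 2 * t) y‖ₑ ^ 2 ≤ C := by
      refine le_trans (le_of_eq (lintegral_congr fun y => ?_)) (hC _ hs)
      rw [← ofReal_norm, ← ofReal_norm (iteratedFDeriv ℝ 0 _ y), norm_iteratedFDeriv_zero]
    calc ∫⁻ x, ‖nsRescale c u t x‖ₑ ^ 2 = ∫⁻ x, ‖c‖ₑ ^ 2 * ‖u (c ^ 2 * t) (c • x)‖ₑ ^ 2 := by
          refine lintegral_congr fun x => ?_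
          rw [nsRescale_apply, enorm_smul, mul_pow]
      _ = ‖c‖ₑ ^ 2 * ∫⁻ x, ‖u (c ^ 2 * t) (c • x)‖ₑ ^ 2 :=
          lintegral_const_mul' _ _ (ENNReal.pow_ne_top enorm_ne_top)
      _ ≤ ‖c‖ₑ ^ 2 * (ENNReal.ofReal |(c ^ Module.finrank ℝ ℝ³)⁻¹| * C) := by
          rw [hcv]; gcongr
  have hd0 : ∀ m : ℕ, ∫⁻ x, ‖iteratedFDeriv ℝ m (nsRescale c u 0) x‖ₑ ^ 2 < ⊤ := fun m => by
    rw [hinit]; exact hdat.1.2.2 m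
  exact (hcl.hasBoundedSobolevNormsOn_of_sobolevDatum_unforced hν hT₁pos hE hd0).mono
    (Icc_subset_Icc_right (le_max_left _ _))

/-- A global BKM-class solution restricts to a local one on `[0, T)`. -/
theorem isLocalSolution_of_global {ν : ℝ} (T : ℝ) {u₀ : ℝ³ → ℝ³} {u : ℝ → ℝ³ → ℝ³}
    {p : ℝ → ℝ³ → ℝ} (h : Chae2007.IsGlobalSolution ν u₀ u p) :
    Chae2007.IsLocalSolution ν T u₀ u p :=
  ⟨h.isClassical.mono Ico_subset_Ici_self (uniqueDiffOn_Ico 0 T), h.initial,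
    fun T'' _ => h.sobolev T''⟩

/-! ## The datum `u₀ = curl(χ A)` -/

/-- The explicit datum of `SoloRefuteChishtie2025` is in the skeleton's class. -/
theorem isDatum_datum : Santak2026.IsDatum datum :=
  ⟨⟨contDiff_datum, fun x => isDivFree_datum x,
    fun n => lintegral_iteratedFDeriv_sq_lt_top contDiff_datum hasCompactSupport_datum n⟩,
    hasCompactSupport_datum⟩

/-- Its vorticity at the origin: first component `1` (`u₀ = (1, 0, x₁)` near `0`). -/
theorem curl_datum_zero_apply : curl datum 0 0 = 1 := by
  simp [curl, hasFDerivAt_datum.fderiv, VL, Chishtie2025.e]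

/-- Hence `‖ω₀‖_∞ > 0`. -/
theorem vortSup_datum_pos : 0 < Santak2026.vortSup datum := by
  have hne : curl datum 0 ≠ 0 := fun h => by
    have h1 := curl_datum_zero_apply
    rw [h] at h1
    simp at h1
  exact lt_of_lt_of_le (enorm_pos.2 hne) (le_iSup (fun x => ‖curl datum x‖ₑ) 0)

/-! ## The endgame: `rhs7 N y / y² → −∞` -/

/-- For every substrate and every slope `K` there is `y > 0` with `rhs7 N y < K y²`
(take `y = w⁴ − e` with `w` large: `log(e + y) = 4 log w ≤ 4w` while `y ≈ w⁴`). -/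
theorem exists_rhs7_lt (N : Santak2026.Substrate) (K : ℝ) :
    ∃ y : ℝ, 0 < y ∧ Santak2026.rhs7 N y < K * y ^ 2 := by
  have hc₀ := N.c₀_pos
  have hΨ₀ := N.Ψ₀_pos
  obtain ⟨M, hM⟩ : ∃ M : ℝ, M = 4 * |N.C| + 16 * |N.C| / N.Ψ₀ + 3 * N.c₀ + 4 * |K| := ⟨_, rfl⟩
  have hdivnn : 0 ≤ 16 * |N.C| / N.Ψ₀ := div_nonneg (by positivity) hΨ₀.le
  have hMnn : 0 ≤ M := by rw [hM]; linarith [abs_nonneg N.C, abs_nonneg K]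
  obtain ⟨w, hw⟩ : ∃ w : ℝ, w = max 2 (M / N.c₀ + 1) := ⟨_, rfl⟩
  have hw2 : 2 ≤ w := hw ▸ le_max_left _ _
  have hw1 : 1 ≤ w := by linarith
  have hwpos : 0 < w := by linarith
  have hww : w ≤ w ^ 2 := by nlinarith
  have hsq1 : 1 ≤ w ^ 2 := by nlinarith
  have hMw : M < N.c₀ * w ^ 2 := by
    have h1 : M + N.c₀ ≤ N.c₀ * w := by
      have h := mul_le_mul_of_nonneg_left (le_max_right 2 (M / N.c₀ + 1)) hc₀.le
      rw [mul_add, mul_div_cancel₀ _ hc₀.ne', mul_one] at h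
      rw [hw]; exact h
    nlinarith [mul_le_mul_of_nonneg_left hww hc₀.le]
  have he3 : Real.exp 1 < 3 := lt_trans Real.exp_one_lt_d9 (by norm_num)
  obtain ⟨y, hy⟩ : ∃ y : ℝ, y = w ^ 4 - Real.exp 1 := ⟨_, rfl⟩
  have hw4 : (16 : ℝ) ≤ w ^ 4 := by
    have hsq : (4 : ℝ) ≤ w ^ 2 := by nlinarith
    nlinarith
  have hypos : 0 < y := by rw [hy]; linarith
  refine ⟨y, hypos, ?_⟩
  obtain ⟨L, hLdef⟩ : ∃ L : ℝ, L = Real.log (Real.exp 1 + y) := ⟨_, rfl⟩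
  have hL : L = 4 * Real.log w := by
    have hey : Real.exp 1 + y = w ^ 4 := by rw [hy]; ring
    rw [hLdef, hey, Real.log_pow]; norm_num
  have hlogw : 0 < Real.log w := Real.log_pos (by linarith)
  have hlogw' : Real.log w ≤ w := by linarith [Real.log_le_sub_one_of_pos hwpos]
  have hLpos : 0 < L := by rw [hL]; linarith
  have hLle : L ≤ 4 * w := by rw [hL]; linarith
  have hfac : Santak2026.rhs7 N y = (N.C * (1 - L / N.Ψ₀) - N.c₀ * y / L) * y ^ 2 := by
    rw [hLdef]; simp only [Santak2026.rhs7]; ring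
  rw [hfac]
  refine mul_lt_mul_of_pos_right ?_ (pow_pos hypos 2)
  have hq : 0 ≤ L / N.Ψ₀ := div_nonneg hLpos.le hΨ₀.le
  have hp : 0 ≤ (|N.C| + N.C) * (L / N.Ψ₀) := mul_nonneg (by linarith [neg_abs_le N.C]) hq
  have hA : N.C * (1 - L / N.Ψ₀) ≤ |N.C| + |N.C| * (L / N.Ψ₀) := by
    nlinarith [le_abs_self N.C, hp]
  have t1 : |N.C| * (L / N.Ψ₀) ≤ |N.C| * (4 * w / N.Ψ₀) :=
    mul_le_mul_of_nonneg_left (div_le_div_of_nonneg_right hLle hΨ₀.le) (abs_nonneg _)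
  have t2 : N.c₀ * y / (4 * w) ≤ N.c₀ * y / L :=
    div_le_div_of_nonneg_left (mul_pos hc₀ hypos).le hLpos hLle
  have t3 : |N.C| + |N.C| * (4 * w / N.Ψ₀) + |K| < N.c₀ * y / (4 * w) := by
    rw [lt_div_iff₀ (by linarith : (0 : ℝ) < 4 * w)]
    have e1 : (|N.C| + |N.C| * (4 * w / N.Ψ₀) + |K|) * (4 * w)
        = 4 * (w * |N.C|) + 16 * w ^ 2 * (|N.C| / N.Ψ₀) + 4 * (w * |K|) := by ring
    have e2 : w * |N.C| ≤ w ^ 2 * |N.C| := mul_le_mul_of_nonneg_right hww (abs_nonneg N.C)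
    have e3 : w * |K| ≤ w ^ 2 * |K| := mul_le_mul_of_nonneg_right hww (abs_nonneg K)
    have e4 : w ^ 2 * M < w ^ 2 * (N.c₀ * w ^ 2) := mul_lt_mul_of_pos_left hMw (pow_pos hwpos 2)
    have e5 : w ^ 2 * M = 4 * (w ^ 2 * |N.C|) + 16 * w ^ 2 * (|N.C| / N.Ψ₀)
        + 3 * (N.c₀ * w ^ 2) + 4 * (w ^ 2 * |K|) := by rw [hM]; ring
    have e6 : w ^ 2 * (N.c₀ * w ^ 2) = N.c₀ * w ^ 4 := by ring
    have f1 : N.c₀ * 1 ≤ N.c₀ * w ^ 2 := mul_le_mul_of_nonneg_left hsq1 hc₀.le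
    have f2 : N.c₀ * y = N.c₀ * w ^ 4 - N.c₀ * Real.exp 1 := by rw [hy]; ring
    have f3 : N.c₀ * Real.exp 1 < N.c₀ * 3 := mul_lt_mul_of_pos_left he3 hc₀
    rw [e1]
    linarith [e2, e3, e4, e5, e6, f1, f2, f3]
  linarith [hA, t1, t2, t3, neg_abs_le K]

/-! ## The kill -/

/-- **Step 4 — display (7), §5 p.3 l.57–71 — is false for EVERY substrate `N`** (all `c₀, Ψ₀, ω_crit
> 0`, all `C`, all `D`): the asserted ODE for `X(t) = ‖ω(t)‖_∞` along all BKM-class solutions of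
(1)–(2) with `C_c^∞` data is incompatible with the Navier–Stokes scaling `u ↦ c u(c²t, cx)`, along
which `X ↦ c² X`, `dX/dt ↦ c⁴ dX/dt` but `c₀X³/log(e+X) ↦ ~c⁶`. Witness: the rescalings of one local
solution from `u₀ = curl(χ A)` (vorticity `(1,0,0)` at the origin). -/
theorem not_Step4_ODE7 (N : Santak2026.Substrate) : ¬ Santak2026.Step4_ODE7 N := by
  intro h4
  -- one local BKM-class solution from the datum, `ν = 1` (Step 1 = the tree's local theory)
  obtain ⟨T, u, p, hT, hsol⟩ : ∃ (T : ℝ) (u : ℝ → ℝ³ → ℝ³) (p : ℝ → ℝ³ → ℝ), 0 < T ∧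
      Chae2007.IsLocalSolution 1 T datum u p := by
    rcases Santak2026.step1_holds 1 one_pos datum isDatum_datum with ⟨u, p, hg⟩ | ⟨Ts, hTs, u, p, hl, -⟩
    · exact ⟨1, u, p, one_pos, isLocalSolution_of_global 1 hg⟩
    · exact ⟨Ts, u, p, hTs, hl⟩
  obtain ⟨hfin, hcont, hdiff⟩ := h4 1 one_pos T datum u p isDatum_datum hsol
  -- `X(0) > 0`
  have hX0 : 0 < Santak2026.X u 0 := by
    have htop : Santak2026.vortSup (u 0) < ⊤ := hfin 0 ⟨le_rfl, hT⟩
    rw [hsol.initial] at htop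
    rw [Santak2026.X, hsol.initial]
    exact ENNReal.toReal_pos vortSup_datum_pos.ne' htop.ne
  -- a time `s₀ ∈ (0,T)` with `X(s₀) > 0`, by the continuity Step 4 grants
  obtain ⟨s₀, hs₀, hB⟩ : ∃ s₀ ∈ Ioo 0 T, 0 < Santak2026.X u s₀ := by
    have hcw : ContinuousWithinAt (Santak2026.X u) (Ioo 0 T) 0 :=
      (hcont 0 ⟨le_rfl, hT⟩).mono Ioo_subset_Ico_self
    haveI : (𝓝[Ioo 0 T] (0 : ℝ)).NeBot := left_nhdsWithin_Ioo_neBot hT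
    have hev : ∀ᶠ s in 𝓝[Ioo 0 T] (0 : ℝ), 0 < Santak2026.X u s :=
      hcw.eventually (lt_mem_nhds hX0)
    obtain ⟨s, hs, hmem⟩ := (hev.and self_mem_nhdsWithin).exists
    exact ⟨s, hmem, hs⟩
  obtain ⟨hds₀, -⟩ := hdiff s₀ hs₀
  -- the rescaled family: for every `c > 0`, `c⁴ X'(s₀) ≤ rhs7 N (c² X(s₀))`
  have key : ∀ c : ℝ, 0 < c →
      c ^ 2 * (c ^ 2 * deriv (Santak2026.X u) s₀) ≤
        Santak2026.rhs7 N (c ^ 2 * Santak2026.X u s₀) := by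
    intro c hc
    have hc2 : 0 < c ^ 2 := by positivity
    have hsol' := isLocalSolution_nsRescale one_pos hT hc isDatum_datum hsol
    obtain ⟨-, -, hdiff'⟩ :=
      h4 1 one_pos (T / c ^ 2) _ _ _ (isDatum_nsRescaleData isDatum_datum hc.ne') hsol'
    have ht : s₀ / c ^ 2 ∈ Ioo 0 (T / c ^ 2) :=
      ⟨div_pos hs₀.1 hc2, div_lt_div_of_pos_right hs₀.2 hc2⟩
    obtain ⟨-, hle⟩ := hdiff' (s₀ / c ^ 2) ht
    have hXfun : Santak2026.X (nsRescale c u) = fun t => c ^ 2 * Santak2026.X u (c ^ 2 * t) :=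
      funext (X_nsRescale u hc)
    have hcs : c ^ 2 * (s₀ / c ^ 2) = s₀ := mul_div_cancel₀ s₀ hc2.ne'
    have hderiv : HasDerivAt (fun t => c ^ 2 * Santak2026.X u (c ^ 2 * t))
        (c ^ 2 * (c ^ 2 * deriv (Santak2026.X u) s₀)) (s₀ / c ^ 2) := by
      have h1 : HasDerivAt (fun t => c ^ 2 * t) (c ^ 2) (s₀ / c ^ 2) := by
        simpa using (hasDerivAt_id (s₀ / c ^ 2)).const_mul (c ^ 2)
      have h2 : HasDerivAt (Santak2026.X u) (deriv (Santak2026.X u) s₀) (c ^ 2 * (s₀ / c ^ 2)) := by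
        rw [hcs]; exact hds₀.hasDerivAt
      exact ((h2.comp (s₀ / c ^ 2) h1).const_mul (c ^ 2)).congr_deriv (by ring)
    rw [hXfun, hderiv.deriv] at hle
    simpa only [hcs] using hle
  -- choose the scale: `y = c² X(s₀)` with `rhs7 N y < (X'(s₀)/X(s₀)²) y²`
  obtain ⟨y, hy, hlt⟩ := exists_rhs7_lt N (deriv (Santak2026.X u) s₀ / Santak2026.X u s₀ ^ 2)
  have hyB : 0 < y / Santak2026.X u s₀ := div_pos hy hB
  have hk := key (Real.sqrt (y / Santak2026.X u s₀)) (Real.sqrt_pos.2 hyB)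
  rw [Real.sq_sqrt hyB.le, div_mul_cancel₀ y hB.ne'] at hk
  have hrw : deriv (Santak2026.X u) s₀ / Santak2026.X u s₀ ^ 2 * y ^ 2 =
      y / Santak2026.X u s₀ * (y / Santak2026.X u s₀ * deriv (Santak2026.X u) s₀) := by
    field_simp
  linarith

/-- The same statement with the fully qualified locator, for the by-name probe. -/
example : ∀ N : Literature.Claims.NS.Santak2026.Substrate,
    ¬ Literature.Claims.NS.Santak2026.Step4_ODE7 N := not_Step4_ODE7

end Summit.NavierStokesRegularity.NavierStokesRegularity.Theorems.Santak2026
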